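import Summits.QuantumFields.YangMills.Theorems.ColdStartUniversalityEntropyTensorization
import HarnessLib

/-!
# Route `ColdStartUniversality` (fixed-cut-off package, entropy side): entropy sub-additivity over `Measure.pi` for NON-NEGATIVE
# bounded functions (the `δ = 0` boundary case), via the log-sum monotonicity `Ent(g + η) ≤ Ent(g)` and `η ↓ 0`

Helper file (seat `ym-line-csu-p1`, g22; `--supports stmt-QuantumFields-27363`), abstract measure theory in the toolkit namespace
`…ColdStartUniversality.EntropyFlow`, sequel of `…EntropyTensorization` (which needs `0 < δ ≤ f`).  For a probability measure `ρ`,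
`Ent_ρ(g) = ∫ g log g dρ − (∫ g dρ) log(∫ g dρ)`:

* `mul_log_sub_mul_log_add_const_le` — the two-term LOG-SUM INEQUALITY in the form
  `(u+η) log(u+η) − (u+η) log(m+η) ≤ u log u − u log m` (`u ≥ 0`, `m > 0`, `η ≥ 0`; from `log y ≤ y − 1`);
* ★ `entropy_add_const_le` — ADDING A CONSTANT DECREASES THE ENTROPY: `Ent_ρ(g + η) ≤ Ent_ρ(g)` for measurable `0 ≤ g ≤ M`, `η ≥ 0`;
* `tendsto_entropy_add_const` / `entropy_le_of_forall_entropy_add_const_le` — `Ent_ρ(g + 1/(n+1)) → Ent_ρ(g)` (uniform convergence of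
  bounded functions through the continuous `u log u`, g21's `tendsto_integral_comp_of_tendstoUniformly`), so a bound for all
  `Ent_ρ(g + 1/(n+1))` is a bound for `Ent_ρ(g)`;
* ★★ `entropy_pi_le_of_nonneg` — SUB-ADDITIVITY `Ent_π(f) ≤ Σ_i ∫ Ent_{μ i}(t ↦ f(update x i t)) dπ(x)` for measurable `0 ≤ f ≤ M`
  on a finite product `π = Measure.pi μ` of probability spaces (the form needed for `f = F²`, which may vanish).

THEOREMS ONLY, no definition, no sorry.  Nothing here is specific to Yang–Mills; no crux, rung or summit statement is proved; the
Yang–Mills mass gap is NOT proved.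
-/

set_option autoImplicit false

noncomputable section

namespace Summit.QuantumFields.YangMills.Theorems.ColdStartUniversality.EntropyFlow

open MeasureTheory Filter Set Topology Real Function
open scoped NNReal ENNReal BigOperators

/-! ## §1. The two-term log-sum inequality -/

/-- **Two-term log-sum inequality**: `(u+η) log(u+η) − (u+η) log(m+η) ≤ u log u − u log m` for `u ≥ 0`, `m > 0`, `η ≥ 0`
(`= u log(u(m+η)/(m(u+η))) + η log((m+η)/(u+η)) ≥ 0` by `log y ≥ 1 − 1/y`). [folklore] -/
theorem mul_log_sub_mul_log_add_const_le {u m η : ℝ} (hu : 0 ≤ u) (hm : 0 < m) (hη : 0 ≤ η) :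
    (u + η) * Real.log (u + η) - (u + η) * Real.log (m + η) ≤ u * Real.log u - u * Real.log m := by
  rcases hη.lt_or_eq with hη' | hη'
  swap
  · rw [← hη']; simp
  rcases hu.lt_or_eq with hu' | hu'
  swap
  · rw [← hu']
    simp only [zero_add, zero_mul, sub_zero]
    have : Real.log η ≤ Real.log (m + η) := Real.log_le_log hη' (by linarith)
    nlinarith
  -- main case `u, η > 0`
  have hA : 0 < u + η := by linarith
  have hB : 0 < m + η := by linarith
  have e1 : Real.log (m * (u + η) / (u * (m + η))) ≤ m * (u + η) / (u * (m + η)) - 1 :=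
    Real.log_le_sub_one_of_pos (by positivity)
  have e2 : Real.log ((u + η) / (m + η)) ≤ (u + η) / (m + η) - 1 := Real.log_le_sub_one_of_pos (by positivity)
  have l1 : Real.log (m * (u + η) / (u * (m + η))) = Real.log m + Real.log (u + η) - Real.log u - Real.log (m + η) := by
    rw [Real.log_div (by positivity) (by positivity), Real.log_mul hm.ne' hA.ne', Real.log_mul hu'.ne' hB.ne']
    ring
  have l2 : Real.log ((u + η) / (m + η)) = Real.log (u + η) - Real.log (m + η) := Real.log_div hA.ne' hB.ne'
  rw [l1] at e1
  rw [l2] at e2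
  have h1 := mul_le_mul_of_nonneg_left e1 hu
  have h2 := mul_le_mul_of_nonneg_left e2 hη
  have h3 : u * (m * (u + η) / (u * (m + η)) - 1) + η * ((u + η) / (m + η) - 1) = 0 := by
    field_simp
    ring
  nlinarith [h1, h2, h3]

/-! ## §2. Adding a constant decreases the entropy -/

/-- ★ **`Ent_ρ(g + η) ≤ Ent_ρ(g)`** for a probability measure `ρ`, a measurable `g` with `0 ≤ g ≤ M` and a constant `η ≥ 0`
(integrate the two-term log-sum inequality at `m = ∫ g dρ`; if `∫ g dρ = 0` both sides vanish). [folklore] -/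
theorem entropy_add_const_le {Y : Type*} [MeasurableSpace Y] (ρ : Measure Y) [IsProbabilityMeasure ρ] {g : Y → ℝ}
    (hgm : Measurable g) {M : ℝ} (hg0 : ∀ y, 0 ≤ g y) (hgM : ∀ y, g y ≤ M) {η : ℝ} (hη : 0 ≤ η) :
    (∫ y, (g y + η) * Real.log (g y + η) ∂ρ) - (∫ y, (g y + η) ∂ρ) * Real.log (∫ y, (g y + η) ∂ρ) ≤
      (∫ y, g y * Real.log (g y) ∂ρ) - (∫ y, g y ∂ρ) * Real.log (∫ y, g y ∂ρ) := by
  -- integrability of everything in sight (bounded measurable on a probability space)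
  obtain ⟨C, hC⟩ := (isCompact_Icc (a := (0 : ℝ)) (b := M + η)).exists_bound_of_continuousOn
    Real.continuous_mul_log.continuousOn
  have hgi : Integrable g ρ := integrable_of_abs_le ρ hgm (B := M) fun y => by rw [abs_of_nonneg (hg0 y)]; exact hgM y
  have hgηi : Integrable (fun y => g y + η) ρ := hgi.add (integrable_const η)
  have hgl : Integrable (fun y => g y * Real.log (g y)) ρ :=
    integrable_of_abs_le ρ (hgm.mul (Real.measurable_log.comp hgm)) (B := C) fun y => by
      have := hC (g y) ⟨hg0 y, by linarith [hgM y]⟩; rwa [Real.norm_eq_abs] at this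
  have hgηl : Integrable (fun y => (g y + η) * Real.log (g y + η)) ρ :=
    integrable_of_abs_le ρ ((hgm.add_const η).mul (Real.measurable_log.comp (hgm.add_const η))) (B := C) fun y => by
      have := hC (g y + η) ⟨by linarith [hg0 y], by linarith [hgM y]⟩; rwa [Real.norm_eq_abs] at this
  set m : ℝ := ∫ y, g y ∂ρ with hm
  have hmη : ∫ y, (g y + η) ∂ρ = m + η := by
    rw [integral_add hgi (integrable_const η), integral_const, probReal_univ, one_smul]
  rw [hmη]
  rcases (integral_nonneg hg0 : 0 ≤ m).lt_or_eq with hmpos | hm0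
  · -- main case: integrate the pointwise log-sum inequality
    have hpt : ∀ y, (g y + η) * Real.log (g y + η) - (g y + η) * Real.log (m + η) ≤
        g y * Real.log (g y) - g y * Real.log m := fun y => mul_log_sub_mul_log_add_const_le (hg0 y) hmpos hη
    have iL : Integrable (fun y => (g y + η) * Real.log (g y + η) - (g y + η) * Real.log (m + η)) ρ :=
      hgηl.sub (hgηi.mul_const _)
    have iR : Integrable (fun y => g y * Real.log (g y) - g y * Real.log m) ρ := hgl.sub (hgi.mul_const _)
    have hint := integral_mono iL iR hpt
    rw [integral_sub hgηl (hgηi.mul_const _), integral_sub hgl (hgi.mul_const _), integral_mul_const, integral_mul_const,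
      hmη] at hint
    rw [hm]
    exact hint
  · -- degenerate case `∫ g = 0`: `g = 0` a.e.
    have hae : g =ᵐ[ρ] 0 := (integral_eq_zero_iff_of_nonneg hg0 hgi).1 hm0.symm
    have e1 : ∫ y, (g y + η) * Real.log (g y + η) ∂ρ = η * Real.log η := by
      have : (fun y => (g y + η) * Real.log (g y + η)) =ᵐ[ρ] fun _ => η * Real.log η := by
        filter_upwards [hae] with y hy
        simp [hy]
      rw [integral_congr_ae this, integral_const, probReal_univ, one_smul]
    have e2 : ∫ y, g y * Real.log (g y) ∂ρ = 0 := by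
      have : (fun y => g y * Real.log (g y)) =ᵐ[ρ] fun _ => (0 : ℝ) := by
        filter_upwards [hae] with y hy
        simp [hy]
      rw [integral_congr_ae this, integral_const, smul_zero]
    have hm0' : m = 0 := by rw [hm]; exact hm0.symm
    rw [e1, e2, hm0']
    simp

/-! ## §3. `Ent_ρ(g + 1/(n+1)) → Ent_ρ(g)` -/

/-- **`Ent_ρ(g + 1/(n+1)) → Ent_ρ(g)`** for a probability measure `ρ` and a measurable `g` with `0 ≤ g ≤ M` (uniform convergence of
uniformly bounded functions passes through the continuous `u log u` under the integral). [folklore] -/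
theorem tendsto_entropy_add_const {Y : Type*} [MeasurableSpace Y] (ρ : Measure Y) [IsProbabilityMeasure ρ] {g : Y → ℝ}
    (hgm : Measurable g) {M : ℝ} (hg0 : ∀ y, 0 ≤ g y) (hgM : ∀ y, g y ≤ M) :
    Tendsto (fun n : ℕ => (∫ y, (g y + 1 / ((n : ℝ) + 1)) * Real.log (g y + 1 / ((n : ℝ) + 1)) ∂ρ) -
        (∫ y, (g y + 1 / ((n : ℝ) + 1)) ∂ρ) * Real.log (∫ y, (g y + 1 / ((n : ℝ) + 1)) ∂ρ)) atTop
      (𝓝 ((∫ y, g y * Real.log (g y) ∂ρ) - (∫ y, g y ∂ρ) * Real.log (∫ y, g y ∂ρ))) := by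
  have hε : Tendsto (fun n : ℕ => 1 / ((n : ℝ) + 1)) atTop (𝓝 0) := tendsto_one_div_add_atTop_nhds_zero_nat
  have hεpos : ∀ n : ℕ, 0 < 1 / ((n : ℝ) + 1) := fun n => by positivity
  have hεle : ∀ n : ℕ, 1 / ((n : ℝ) + 1) ≤ 1 := fun n => by
    rw [div_le_one (by positivity)]; linarith [n.cast_nonneg (α := ℝ)]
  have hgi : Integrable g ρ := integrable_of_abs_le ρ hgm (B := M) fun y => by rw [abs_of_nonneg (hg0 y)]; exact hgM y
  -- first term: `∫ φ(g + ε_n) → ∫ φ(g)`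
  have h1 : Tendsto (fun n : ℕ => ∫ y, (g y + 1 / ((n : ℝ) + 1)) * Real.log (g y + 1 / ((n : ℝ) + 1)) ∂ρ) atTop
      (𝓝 (∫ y, g y * Real.log (g y) ∂ρ)) := by
    refine tendsto_integral_comp_of_tendstoUniformly (ν := ρ) (w := fun (n : ℕ) y => g y + 1 / ((n : ℝ) + 1)) (w₀ := g)
      (fun n => (hgm.add_const _).aestronglyMeasurable) hgm.aestronglyMeasurable (R := M + 1)
      (fun n y => by rw [abs_of_nonneg (by linarith [hg0 y, hεpos n])]; linarith [hgM y, hεle n])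
      (fun y => by rw [abs_of_nonneg (hg0 y)]; linarith [hgM y]) ?_ (φ := fun u => u * Real.log u) Real.continuous_mul_log
    rw [Metric.tendstoUniformly_iff]
    intro ε hεp
    filter_upwards [(Metric.tendsto_nhds.1 hε) ε hεp] with n hn y
    rw [Real.dist_eq, sub_zero] at hn
    rw [Real.dist_eq]
    have : g y - (g y + 1 / ((n : ℝ) + 1)) = -(1 / ((n : ℝ) + 1)) := by ring
    rw [this, abs_neg]; exact hn
  -- second term: `φ(∫ g + ε_n) → φ(∫ g)`
  have h2 : Tendsto (fun n : ℕ => (∫ y, (g y + 1 / ((n : ℝ) + 1)) ∂ρ) * Real.log (∫ y, (g y + 1 / ((n : ℝ) + 1)) ∂ρ)) atTop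
      (𝓝 ((∫ y, g y ∂ρ) * Real.log (∫ y, g y ∂ρ))) := by
    have e : ∀ n : ℕ, ∫ y, (g y + 1 / ((n : ℝ) + 1)) ∂ρ = (∫ y, g y ∂ρ) + 1 / ((n : ℝ) + 1) := fun n => by
      rw [integral_add hgi (integrable_const _), integral_const, probReal_univ, one_smul]
    simp_rw [e]
    have hm : Tendsto (fun n : ℕ => (∫ y, g y ∂ρ) + 1 / ((n : ℝ) + 1)) atTop (𝓝 (∫ y, g y ∂ρ)) := by
      have := tendsto_const_nhds.add hε (f := fun _ : ℕ => ∫ y, g y ∂ρ)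
      rwa [add_zero] at this
    exact (Real.continuous_mul_log.tendsto _).comp hm
  exact h1.sub h2

/-- **A bound for every `Ent_ρ(g + 1/(n+1))` is a bound for `Ent_ρ(g)`** (`0 ≤ g ≤ M` measurable, `ρ` a probability measure).
[folklore] -/
theorem entropy_le_of_forall_entropy_add_const_le {Y : Type*} [MeasurableSpace Y] (ρ : Measure Y) [IsProbabilityMeasure ρ]
    {g : Y → ℝ} (hgm : Measurable g) {M : ℝ} (hg0 : ∀ y, 0 ≤ g y) (hgM : ∀ y, g y ≤ M) {B : ℝ}
    (hB : ∀ n : ℕ, (∫ y, (g y + 1 / ((n : ℝ) + 1)) * Real.log (g y + 1 / ((n : ℝ) + 1)) ∂ρ) -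
        (∫ y, (g y + 1 / ((n : ℝ) + 1)) ∂ρ) * Real.log (∫ y, (g y + 1 / ((n : ℝ) + 1)) ∂ρ) ≤ B) :
    (∫ y, g y * Real.log (g y) ∂ρ) - (∫ y, g y ∂ρ) * Real.log (∫ y, g y ∂ρ) ≤ B :=
  le_of_tendsto' (tendsto_entropy_add_const ρ hgm hg0 hgM) hB

/-! ## §4. Sub-additivity for non-negative bounded functions -/

section Pi

variable {ι : Type*} [Fintype ι] [DecidableEq ι] {X : ι → Type*} [∀ i, MeasurableSpace (X i)]
  (μ : ∀ i, Measure (X i)) [∀ i, IsProbabilityMeasure (μ i)]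

/-- ★★ **Sub-additivity of the entropy over a finite product, non-negative case**: for probability measures `μ i`, `π = Measure.pi μ`
and a measurable `f` with `0 ≤ f ≤ M`, `Ent_π(f) ≤ Σ_i ∫ Ent_{μ i}(t ↦ f(update x i t)) dπ(x)`.  (`entropy_pi_le` for `f + 1/(n+1)`,
`Ent_{μ i}(f(update x i ·) + η) ≤ Ent_{μ i}(f(update x i ·))` pointwise in `x`, and `n → ∞` on the left.)
[cite: BakryGentilLedoux2014, Prop. 5.2.7] -/
theorem entropy_pi_le_of_nonneg {f : (Π j, X j) → ℝ} (hfm : Measurable f) {M : ℝ} (hf0 : ∀ x, 0 ≤ f x) (hfM : ∀ x, f x ≤ M) :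
    (∫ x, f x * Real.log (f x) ∂Measure.pi μ) - (∫ x, f x ∂Measure.pi μ) * Real.log (∫ x, f x ∂Measure.pi μ) ≤
      ∑ i, ∫ x, ((∫ t, f (update x i t) * Real.log (f (update x i t)) ∂μ i) -
        (∫ t, f (update x i t) ∂μ i) * Real.log (∫ t, f (update x i t) ∂μ i)) ∂Measure.pi μ := by
  refine entropy_le_of_forall_entropy_add_const_le (Measure.pi μ) hfm hf0 hfM fun n => ?_
  set η : ℝ := 1 / ((n : ℝ) + 1) with hη
  have hηpos : 0 < η := by positivity
  -- tensorisation for `f + η ≥ η > 0`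
  have h1 := entropy_pi_le μ (f := fun x => f x + η) (hfm.add_const η) hηpos (fun x => by linarith [hf0 x])
    (fun x => by linarith [hfM x] : ∀ x, f x + η ≤ M + η)
  refine h1.trans (Finset.sum_le_sum fun i _ => ?_)
  -- per coordinate: `Ent_{μ i}(f(update x i ·) + η) ≤ Ent_{μ i}(f(update x i ·))`, integrated in `x`
  obtain ⟨C, hC⟩ := (isCompact_Icc (a := (0 : ℝ)) (b := M + η)).exists_bound_of_continuousOn
    Real.continuous_mul_log.continuousOn
  have hφC : ∀ u, 0 ≤ u → u ≤ M + η → |u * Real.log u| ≤ C := fun u h0 h1 => by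
    have := hC u ⟨h0, h1⟩; rwa [Real.norm_eq_abs] at this
  -- integrability of the two coordinate entropies over `π` (bounded measurable)
  have hEi : ∀ (h : (Π j, X j) → ℝ), Measurable h → (∀ x, 0 ≤ h x) → (∀ x, h x ≤ M + η) →
      Integrable (fun x => (∫ t, h (update x i t) * Real.log (h (update x i t)) ∂μ i) -
        (∫ t, h (update x i t) ∂μ i) * Real.log (∫ t, h (update x i t) ∂μ i)) (Measure.pi μ) := by
    intro h hh h0 hM'
    have hm1 : Measurable fun x => ∫ t, h (update x i t) * Real.log (h (update x i t)) ∂μ i :=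
      measurable_integral_update μ i (g := fun x => h x * Real.log (h x)) (hh.mul (Real.measurable_log.comp hh))
    have hm2 : Measurable fun x => ∫ t, h (update x i t) ∂μ i := measurable_integral_update μ i hh
    refine integrable_of_abs_le (Measure.pi μ) (hm1.sub (hm2.mul (Real.measurable_log.comp hm2))) (B := C + C) fun x => ?_
    have hmean0 : 0 ≤ ∫ t, h (update x i t) ∂μ i := integral_nonneg fun t => h0 _
    have hmeanM : ∫ t, h (update x i t) ∂μ i ≤ M + η := by
      have hi' : Integrable (fun t => h (update x i t)) (μ i) :=
        integrable_of_abs_le (μ i) (hh.comp (measurable_update x)) (B := M + η) fun t => by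
          rw [abs_of_nonneg (h0 _)]; exact hM' _
      have := integral_mono hi' (integrable_const (M + η)) fun t => hM' _
      rwa [integral_const, probReal_univ, one_smul] at this
    exact (abs_sub _ _).trans (add_le_add (abs_integral_le_of_abs_le (μ i) fun t => hφC _ (h0 _) (hM' _))
      (hφC _ hmean0 hmeanM))
  refine integral_mono (hEi (fun x => f x + η) (hfm.add_const η) (fun x => by linarith [hf0 x]) (fun x => by linarith [hfM x]))
    (hEi f hfm hf0 (fun x => by linarith [hfM x])) fun x => ?_
  exact entropy_add_const_le (μ i) (g := fun t => f (update x i t)) (hfm.comp (measurable_update x)) (M := M)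
    (fun t => hf0 _) (fun t => hfM _) hηpos.le

end Pi

end Summit.QuantumFields.YangMills.Theorems.ColdStartUniversality.EntropyFlow

end
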